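import Summits.Ventures.PercRepro.GenQSolidBadSets

/-!
# PercRepro — the row (R5a): the big solids pay demand-free sets themselves, assembled (night-4, gen 4)

With the bad sets of `GenQSolidBadSets` (injecting into the pairs (plane, subset)) and the plane budget
`16 p₆ + 7 p₅ + 3 p₄ ≤ C(s, 3)` (`GenQSolidTriples`), a solid with `10` (`9`) points of `G` carries at least
`c₅ = 166` (`20`) five-subsets of rank `4` with spanning complement — demand-free at type `5` and distinct across solids.

* `goodFives`, `card_rank_four_eq_good_add_bad`: the rank-`4` five-subsets are the good plus the bad ones;
* `plane_budget`: `16·p₆ + 7·p₅ + 3·p₄ ≤ C(|X|, 3)`;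
* `card_good_fives_ge`: `c₅(|F ∩ G|) ≤ #good`;
* `sum_good_le`: the good sets of the solids are disjoint demand-free level-`5` sets;
* `DFq_five_ge_big_solids`: the row (R5a) — `DF₅ ≥ #{|G ∖ S| < 5} + 166·N4 10 + 20·N4 9`.

Imports `GenQSolidBadSets`.
-/
namespace PercRepro.Night4

open Finset ThmH SixFour GenQ PerFlat Star

variable {α : Type*} [DecidableEq α] {M : Matroid α} [M.Finite]

/-! ## The good sets of a big solid -/

/-- The good `5`-subsets of `F ∩ G`: rank `4` and spanning complement — demand-free at type `5`. -/
noncomputable def goodFives (M : Matroid α) [M.Finite] (G F : Finset α) (q : ℕ) : Finset (Finset α) :=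
  ((F ∩ G).powersetCard 5).filter
    (fun A : Finset α => M.eRk (A : Set α) = ((4 : ℕ) : ℕ∞) ∧ G \ A ∈ Rq M G q)

/-- The rank-`4` five-subsets of `F ∩ G` are the good ones plus the bad ones. -/
theorem card_rank_four_eq_good_add_bad (G F : Finset α) (q : ℕ) :
    (((F ∩ G).powersetCard 5).filter (fun A : Finset α => M.eRk (A : Set α) = ((4 : ℕ) : ℕ∞))).card =
      (goodFives M G F q).card + (badFives M G F q).card := by
  unfold goodFives badFives
  rw [← Finset.card_union_of_disjoint (by
    rw [Finset.disjoint_filter]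
    intro A _ h1 h2
    exact h2.2 h1.2)]
  congr 1
  ext A
  simp only [Finset.mem_filter, Finset.mem_union]
  constructor
  · rintro ⟨hA, hr⟩
    by_cases h : G \ A ∈ Rq M G q
    · exact Or.inl ⟨hA, hr, h⟩
    · exact Or.inr ⟨hA, hr, h⟩
  · rintro (⟨hA, hr, _⟩ | ⟨hA, hr, _⟩) <;> exact ⟨hA, hr⟩

/-- The plane budget of a set `X` (lines `≤ 3`, planes `≤ 6`): `16·p₆ + 7·p₅ + 3·p₄ ≤ C(|X|, 3)`. -/
theorem plane_budget (hs : Simple M) (hline : ∀ L ∈ flatsQ M 2, L.card ≤ 3) {X : Finset α} (hX : X ⊆ gr M) :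
    16 * ((flatsQ M 3).filter (fun P : Finset α => (P ∩ X).card = 6)).card +
      7 * ((flatsQ M 3).filter (fun P : Finset α => (P ∩ X).card = 5)).card +
      3 * ((flatsQ M 3).filter (fun P : Finset α => (P ∩ X).card = 4)).card ≤ X.card.choose 3 := by
  have hge : ∀ P ∈ flatsQ M 3, 16 * (if (P ∩ X).card = 6 then 1 else 0) + 7 * (if (P ∩ X).card = 5 then 1 else 0) +
      3 * (if (P ∩ X).card = 4 then 1 else 0) ≤
      (((P ∩ X).powersetCard 3).filter (fun T : Finset α => M.eRk (T : Set α) = ((3 : ℕ) : ℕ∞))).card := by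
    intro P _
    have hPX : P ∩ X ⊆ gr M := Finset.inter_subset_right.trans hX
    have h := card_rank_three_triples_ge hs hline hPX
    by_cases h6 : (P ∩ X).card = 6
    · simp only [h6, if_true, show (6 : ℕ) ≠ 5 by norm_num, show (6 : ℕ) ≠ 4 by norm_num, if_false]
      have := h.1 h6
      norm_num at this ⊢
      exact this
    · by_cases h5 : (P ∩ X).card = 5
      · simp only [h5, if_true, show (5 : ℕ) ≠ 6 by norm_num, show (5 : ℕ) ≠ 4 by norm_num, if_false]
        have := h.2.1 h5
        norm_num at this ⊢
        exact this
      · by_cases h4 : (P ∩ X).card = 4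
        · simp only [h4, if_true, show (4 : ℕ) ≠ 6 by norm_num, show (4 : ℕ) ≠ 5 by norm_num, if_false]
          have := h.2.2 h4
          norm_num at this ⊢
          exact this
        · simp only [h6, h5, h4, if_false]
          exact Nat.zero_le _
  calc 16 * ((flatsQ M 3).filter (fun P : Finset α => (P ∩ X).card = 6)).card +
        7 * ((flatsQ M 3).filter (fun P : Finset α => (P ∩ X).card = 5)).card +
        3 * ((flatsQ M 3).filter (fun P : Finset α => (P ∩ X).card = 4)).card =
      ∑ P ∈ flatsQ M 3, (16 * (if (P ∩ X).card = 6 then 1 else 0) + 7 * (if (P ∩ X).card = 5 then 1 else 0) +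
        3 * (if (P ∩ X).card = 4 then 1 else 0)) := by
        rw [Finset.sum_add_distrib, Finset.sum_add_distrib, ← Finset.mul_sum, ← Finset.mul_sum, ← Finset.mul_sum,
          Finset.card_filter, Finset.card_filter, Finset.card_filter]
    _ ≤ ∑ P ∈ flatsQ M 3, (((P ∩ X).powersetCard 3).filter
        (fun T : Finset α => M.eRk (T : Set α) = ((3 : ℕ) : ℕ∞))).card := Finset.sum_le_sum hge
    _ ≤ X.card.choose 3 := sum_planes_rank_three_triples_le hX

/-- **`c₅(|F ∩ G|) ≤ #good`**: a solid with `10` (`9`) points of `G` carries `≥ 166` (`≥ 20`) good five-subsets. -/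
theorem card_good_fives_ge (hs : Simple M) (hline : ∀ L ∈ flatsQ M 2, L.card ≤ 3)
    (hplane : ∀ P ∈ flatsQ M 3, P.card ≤ 6) {G F : Finset α} {q : ℕ} (hG : G ⊆ gr M)
    (hrG : M.eRk (G : Set α) = (q : ℕ∞)) (hF : F ∈ flatsQ M 4) :
    c5 (F ∩ G).card ≤ (goodFives M G F q).card := by
  by_cases hs9 : 9 ≤ (F ∩ G).card ∧ (F ∩ G).card ≤ 10
  · have hXg : F ∩ G ⊆ gr M := Finset.inter_subset_right.trans hG
    have hp6 : ∀ P ∈ flatsQ M 3, (P ∩ (F ∩ G)).card ≤ 6 :=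
      fun P hP => (Finset.card_le_card Finset.inter_subset_left).trans (hplane P hP)
    have hbudget := plane_budget hs hline hXg
    have htot := choose_five_le_rank_four_add_three hs hline hF (Finset.inter_subset_left (s₂ := G))
    have hsplit := card_rank_four_eq_good_add_bad (M := M) G F q
    have h3 := card_rank_three_fives_le (M := M) hXg (X := F ∩ G)
    have hbad := card_bad_fives_le hs hline hG hrG hF hs9.1
    -- the sums over the planes in terms of the plane counts `a, b, c`
    have hsum5 : ∑ P ∈ flatsQ M 3, (P ∩ (F ∩ G)).card.choose 5 =
        6 * ((flatsQ M 3).filter (fun P : Finset α => (P ∩ (F ∩ G)).card = 6)).card +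
          ((flatsQ M 3).filter (fun P : Finset α => (P ∩ (F ∩ G)).card = 5)).card := by
      have h6 : ∀ P ∈ flatsQ M 3, (P ∩ (F ∩ G)).card.choose 5 =
          6 * (if (P ∩ (F ∩ G)).card = 6 then 1 else 0) + (if (P ∩ (F ∩ G)).card = 5 then 1 else 0) := by
        intro P hP
        have := hp6 P hP
        interval_cases h : (P ∩ (F ∩ G)).card <;> decide
      rw [Finset.sum_congr rfl h6, Finset.sum_add_distrib, ← Finset.mul_sum, Finset.card_filter, Finset.card_filter]
    rw [hsum5] at h3
    rcases (show (F ∩ G).card = 10 ∨ (F ∩ G).card = 9 by omega) with h10 | h9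
    · have hsumbad : ∑ P ∈ (flatsQ M 3).filter (fun P : Finset α => (F ∩ G).card - 5 ≤ (P ∩ (F ∩ G)).card),
          (P ∩ (F ∩ G)).card.choose ((P ∩ (F ∩ G)).card + 5 - (F ∩ G).card) =
          6 * ((flatsQ M 3).filter (fun P : Finset α => (P ∩ (F ∩ G)).card = 6)).card +
            ((flatsQ M 3).filter (fun P : Finset α => (P ∩ (F ∩ G)).card = 5)).card := by
        rw [h10]
        have h6 : ∀ P ∈ (flatsQ M 3).filter (fun P : Finset α => 10 - 5 ≤ (P ∩ (F ∩ G)).card),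
            (P ∩ (F ∩ G)).card.choose ((P ∩ (F ∩ G)).card + 5 - 10) =
            6 * (if (P ∩ (F ∩ G)).card = 6 then 1 else 0) + (if (P ∩ (F ∩ G)).card = 5 then 1 else 0) := by
          intro P hP
          have hP' := Finset.mem_filter.1 hP
          have := hp6 P hP'.1
          have h5 : 5 ≤ (P ∩ (F ∩ G)).card := hP'.2
          interval_cases h : (P ∩ (F ∩ G)).card <;> decide
        rw [Finset.sum_congr rfl h6, Finset.sum_add_distrib, ← Finset.mul_sum, Finset.sum_filter, Finset.sum_filter,
          Finset.card_filter, Finset.card_filter]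
        congr 1
        · congr 1
          apply Finset.sum_congr rfl
          intro P _
          by_cases h : (P ∩ (F ∩ G)).card = 6 <;> simp [h]
        · apply Finset.sum_congr rfl
          intro P _
          by_cases h : (P ∩ (F ∩ G)).card = 5 <;> simp [h]
      rw [hsumbad] at hbad
      unfold c5
      rw [h10] at hbudget htot ⊢
      simp only [if_true]
      have hch : Nat.choose 10 5 = 252 := by decide
      have hch3 : Nat.choose 10 3 = 120 := by decide
      rw [hch] at htot
      rw [hch3] at hbudget
      omega
    · have hsumbad : ∑ P ∈ (flatsQ M 3).filter (fun P : Finset α => (F ∩ G).card - 5 ≤ (P ∩ (F ∩ G)).card),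
          (P ∩ (F ∩ G)).card.choose ((P ∩ (F ∩ G)).card + 5 - (F ∩ G).card) =
          15 * ((flatsQ M 3).filter (fun P : Finset α => (P ∩ (F ∩ G)).card = 6)).card +
            5 * ((flatsQ M 3).filter (fun P : Finset α => (P ∩ (F ∩ G)).card = 5)).card +
            ((flatsQ M 3).filter (fun P : Finset α => (P ∩ (F ∩ G)).card = 4)).card := by
        rw [h9]
        have h6 : ∀ P ∈ (flatsQ M 3).filter (fun P : Finset α => 9 - 5 ≤ (P ∩ (F ∩ G)).card),
            (P ∩ (F ∩ G)).card.choose ((P ∩ (F ∩ G)).card + 5 - 9) =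
            15 * (if (P ∩ (F ∩ G)).card = 6 then 1 else 0) + 5 * (if (P ∩ (F ∩ G)).card = 5 then 1 else 0) +
              (if (P ∩ (F ∩ G)).card = 4 then 1 else 0) := by
          intro P hP
          have hP' := Finset.mem_filter.1 hP
          have := hp6 P hP'.1
          have h4 : 4 ≤ (P ∩ (F ∩ G)).card := hP'.2
          interval_cases h : (P ∩ (F ∩ G)).card <;> decide
        rw [Finset.sum_congr rfl h6, Finset.sum_add_distrib, Finset.sum_add_distrib, ← Finset.mul_sum,
          ← Finset.mul_sum, Finset.sum_filter, Finset.sum_filter, Finset.sum_filter, Finset.card_filter,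
          Finset.card_filter, Finset.card_filter]
        congr 1
        · congr 1
          · congr 1
            apply Finset.sum_congr rfl
            intro P _
            by_cases h : (P ∩ (F ∩ G)).card = 6 <;> simp [h]
          · congr 1
            apply Finset.sum_congr rfl
            intro P _
            by_cases h : (P ∩ (F ∩ G)).card = 5 <;> simp [h]
        · apply Finset.sum_congr rfl
          intro P _
          by_cases h : (P ∩ (F ∩ G)).card = 4 <;> simp [h]
      rw [hsumbad] at hbad
      unfold c5
      rw [h9] at hbudget htot ⊢
      simp only [show (9 : ℕ) ≠ 10 by norm_num, if_false, if_true]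
      have hch : Nat.choose 9 5 = 126 := by decide
      have hch3 : Nat.choose 9 3 = 84 := by decide
      rw [hch] at htot
      rw [hch3] at hbudget
      -- omega (no dark shadows) needs the case split on the number of `6`-point planes
      set a := ((flatsQ M 3).filter (fun P : Finset α => (P ∩ (F ∩ G)).card = 6)).card with ha
      have ha5 : a ≤ 5 := by omega
      interval_cases a <;> omega
  · have : c5 (F ∩ G).card = 0 := by
      unfold c5
      have : ¬ (F ∩ G).card = 10 ∧ ¬ (F ∩ G).card = 9 := by omega
      simp only [this.1, this.2, if_false]
    rw [this]
    exact Nat.zero_le _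

/-- The good sets of the solids are disjoint demand-free level-`5` sets: `Σ_F #good F ≤ #{A ∈ coSpan : rk A ≤ 4}`. -/
theorem sum_good_le (G : Finset α) (q : ℕ) :
    ∑ F ∈ flatsQ M 4, (goodFives M G F q).card ≤
      ((coSpan M G q 5).filter (fun A : Finset α => M.eRk (A : Set α) + 1 ≤ ((5 : ℕ) : ℕ∞))).card := by
  rw [← Finset.card_sigma]
  apply Finset.card_le_card_of_injOn (fun p => p.2)
  · intro p hp
    rw [Finset.mem_coe, Finset.mem_sigma] at hp
    obtain ⟨F, A⟩ := p
    simp only at hp ⊢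
    unfold goodFives at hp
    rw [Finset.mem_filter, Finset.mem_powersetCard] at hp
    obtain ⟨hF, ⟨hAF, hAc⟩, hAr, hsp⟩ := hp
    rw [Finset.mem_coe, Finset.mem_filter]
    unfold coSpan
    rw [Finset.mem_filter, Finset.mem_powersetCard]
    refine ⟨⟨⟨hAF.trans Finset.inter_subset_right, hAc⟩, hsp⟩, ?_⟩
    rw [hAr]
    norm_num
  · intro p hp p' hp' heq
    rw [Finset.mem_coe, Finset.mem_sigma] at hp hp'
    obtain ⟨F, A⟩ := p
    obtain ⟨F', A'⟩ := p'
    simp only at heq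
    subst heq
    -- `F = cl A = F'`
    have hF := mem_flatsQ.1 hp.1
    have hF' := mem_flatsQ.1 hp'.1
    unfold goodFives at hp hp'
    rw [Finset.mem_filter, Finset.mem_powersetCard] at hp hp'
    have hcl : ∀ {F₀ : Finset α}, F₀ ⊆ gr M → M.IsFlat (F₀ : Set α) → M.eRk (F₀ : Set α) = ((4 : ℕ) : ℕ∞) →
        A ⊆ F₀ ∩ G → M.closure (A : Set α) = (F₀ : Set α) := by
      intro F₀ _ hfl hr hAF₀
      have hsub : (A : Set α) ⊆ (F₀ : Set α) := Finset.coe_subset.2 (hAF₀.trans Finset.inter_subset_left)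
      have := (M.isRkFinite_of_finite (Finset.finite_toSet A)).closure_eq_closure_of_subset_of_eRk_ge_eRk hsub
        (by rw [hr, hp.2.2.1])
      rw [this, hfl.closure]
    have h1 := hcl hF.1 hF.2.1 hF.2.2 hp.2.1.1
    have h2 := hcl hF'.1 hF'.2.1 hF'.2.2 hp'.2.1.1
    have : (F : Set α) = (F' : Set α) := by rw [← h1, ← h2]
    rw [Finset.coe_injective this]

/-- Grouping the solids by their number of points of `G`: `Σ_F c₅(|F ∩ G|) = 166·N4 10 + 20·N4 9`. -/
theorem sum_solids_c5_eq (G : Finset α) :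
    ∑ F ∈ flatsQ M 4, c5 (F ∩ G).card = 166 * N4 M G 10 + 20 * N4 M G 9 := by
  have h : ∀ F ∈ flatsQ M 4, c5 (F ∩ G).card =
      166 * (if (F ∩ G).card = 10 then 1 else 0) + 20 * (if (F ∩ G).card = 9 then 1 else 0) := by
    intro F _
    unfold c5
    by_cases h10 : (F ∩ G).card = 10
    · simp [h10]
    · by_cases h9 : (F ∩ G).card = 9
      · simp [h9]
      · simp [h10, h9]
  rw [Finset.sum_congr rfl h, Finset.sum_add_distrib, ← Finset.mul_sum, ← Finset.mul_sum]
  unfold N4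
  rw [Finset.card_filter, Finset.card_filter]

/-- **THE ROW (R5a) of the type-`5` LP**: `DF₅ ≥ #{|G ∖ S| < 5} + 166·N4 10 + 20·N4 9` on a rank-`q` set `G` of a
simple matroid with lines `≤ 3` and planes `≤ 6` points. -/
theorem DFq_five_ge_big_solids (hs : Simple M) (hline : ∀ L ∈ flatsQ M 2, L.card ≤ 3)
    (hplane : ∀ P ∈ flatsQ M 3, P.card ≤ 6) {G : Finset α} {q : ℕ} (hG : G ⊆ gr M)
    (hrG : M.eRk (G : Set α) = (q : ℕ∞)) :
    ((Rq M G q).filter (fun S : Finset α => (G \ S).card < 5)).card + (166 * N4 M G 10 + 20 * N4 M G 9) ≤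
      DFq M G q 5 := by
  have h1 := DFq_ge_levels_add_rank_le (M := M) G q 5
  have h2 := sum_good_le (M := M) G q
  have h3 : ∑ F ∈ flatsQ M 4, c5 (F ∩ G).card ≤ ∑ F ∈ flatsQ M 4, (goodFives M G F q).card :=
    Finset.sum_le_sum (fun F hF => card_good_fives_ge hs hline hplane hG hrG hF)
  rw [sum_solids_c5_eq] at h3
  omega

end PercRepro.Night4

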